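import Summits.QuantumFields.BalabanUV.T4Continuum.Support.NE7MinActHessianFlatCurl
import Summits.QuantumFields.BalabanUV.T4Continuum.Support.NE7SecondOrderChainRule
import Summits.QuantumFields.BalabanUV.T4Continuum.Support.AveragingDeficitMultiLevelFermat
import Summits.QuantumFields.BalabanUV.T4Continuum.Support.AveragingDeficitMultiLevelBridge
import Summits.QuantumFields.BalabanUV.T4Continuum.Support.AveragingDeficitFermat
import Summits.QuantumFields.BalabanUV.T4Continuum.Support.NE7TorusChartDecoding
import HarnessLib

/-!
# NE7DeficitChartSmoothFlat — THE AVERAGING DEFICIT READ IN THE EXPONENTIAL CHART AT THE FLAT CONFIGURATION IS `C²` AT `0` (companion of ✓ `NE7DeficitSecondVariationFlat`; ROAD-G115 §9)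

`d = 4`, one averaging step (`L ≥ 1`, coarse period `N`, fine period `L·N`): the map `s ↦ 𝓓(chart_1 s)` on `skewSub (L·N)`, `𝓓(V) = deficit L V (blockWindow L (periodBox N))`, is
`C²` at `0` (**`contDiffAt_deficit_chart_flat`**) — near `0` it equals `𝒜_N(Θ s) − 𝒜_{LN}(s)` with `Θ = levelQ L N 0 1 ∘ chart_1` (decoding ✓ `chart_skewPR_relLog_eq`, ✓ `fineAction_rescale_bavg`),
both `C²` (✓ `contDiffAt_fineAction_chart`, ✓ `contDiffAt_levelQ`).  Used by the route of ROAD-G115 §9 to differentiate the deficit twice along `t ↦ e^{tX}` (the curvature bound from the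
periodic derivative wall).
Cell `pub-balaban`, rung (B)+1 sub-cell t4, lineage `b2b-balaban-t4-ne7-p1` (CRUX PROVER NE7 #1 = OWNER of BINDER row NE7), generation 115.  Memo `t4/b2b-balaban-t4-ne7-p1-g115/ROAD-G115.md` §9.
WHAT ([folklore]; 0 def, 0 sorry).  HONEST FRAMING (page 1): an IDENTITY at the flat configuration (no estimate yet); nothing of Bałaban's asserted; NOT NE7, NOT NE3; spine 0∕9; NOT infinite volume,
NOT mass gap, NOT BetaPertH, NOT Clay.
-/

set_option autoImplicit false

open scoped BigOperators Matrix Matrix.Norms.L2Operator Topology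
open NormedSpace Finset Set Filter Metric

namespace Summit.QuantumFields.BalabanUV.T4Continuum.NE7DeficitChartSmoothFlat

open Literature.MathematicalPhysics.QuantumFieldTheory.Balaban1983to89
open B7Prop1Explicit B7Prop2Explicit
open T4AveragingDeficitWall (IsUnitaryCfg SmallField fineAction coarseAction deficit blockWindow curl)
open T4AveragingDeficitWallBoundary (IsPeriodicCfg periodBox)
open AveragingDeficitTorusChart (TDir chart chartDir chart_zero isUnitaryCfg_chart isPeriodicCfg_chart)
open AveragingDeficitChartCalculus (relLog cavg contDiffAt_fineAction_chart)
open AveragingDeficitTwoLevelPrep (skewSub skewPR twoLevelSmall)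
open AveragingDeficitMultiLevelPrep (tower levelQ levelQ' levelQ_self LevelSmall cavgIter cavgIter_unitary_small isPeriodicCfg_cavgIter)
open AveragingDeficitMultiLevelFermat (hasStrictFDerivAt_levelQ continuousAt_cavgIter_chart)
open AveragingDeficitMultiLevelBridge (cavg_eq_rescale_bavg)
open AveragingDeficitFermat (eventually_smallField_chart)
open MinimalActionLevels (perWin fineAction_nonneg fineAction_rescale_bavg blockWindow_periodBox_snd)
open MinimalActionWitness (flatCfg isPeriodicCfg_flatCfg fineAction_flatCfg rescale_bavg_flatCfg)
open MatrixNorms (nhsNormSq)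
open NE3FlatHessianCurl (isUnitaryCfg_flatCfg smallField_flatCfg_zero)
open NE7AdmissibleFibreLHC (chart_id_eq_chart_skewP)
open NE7TorusChartDecoding (chart_skewPR_relLog_eq)
open NE7FibreStraightening (contDiffAt_levelQ)

noncomputable section

variable {n : Type} [Fintype n] [DecidableEq n]

set_option maxHeartbeats 1600000 in
/-- **THE DEFICIT IN THE CHART AT THE FLAT CONFIGURATION IS `C²` AT `0`** (see the module docstring). [folklore] -/
theorem contDiffAt_deficit_chart_flat [Nonempty n] {L : ℕ} [NeZero L] (hL : 1 ≤ L) (N : ℕ) [NeZero N] :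
    haveI : NeZero (L * N) := ⟨Nat.mul_ne_zero (NeZero.ne L) (NeZero.ne N)⟩
    ContDiffAt ℝ 2 (fun s : ↥(skewSub 4 n (L * N)) =>
        deficit L (chart (ContinuousLinearMap.id ℝ (Matrix n n ℂ)) (L * N) (flatCfg : Site 4 → Fin 4 → (Matrix n n ℂ)ˣ) (s : TDir 4 n (L * N)))
          (blockWindow L (periodBox (d := 4) N))) 0 := by
  haveI : NeZero (L * N) := ⟨Nat.mul_ne_zero (NeZero.ne L) (NeZero.ne N)⟩
  haveI : CompleteSpace ↥(skewSub 4 n (L * N)) := FiniteDimensional.complete ℝ _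
  haveI : CompleteSpace ↥(skewSub 4 n N) := FiniteDimensional.complete ℝ _
  set V₀ : Site 4 → Fin 4 → (Matrix n n ℂ)ˣ := flatCfg with hV₀def
  have hV₀u : IsUnitaryCfg V₀ := isUnitaryCfg_flatCfg
  have hV₀PN : IsPeriodicCfg V₀ (N : ℤ) := isPeriodicCfg_flatCfg _
  have hV₀PM : IsPeriodicCfg V₀ ((L * N : ℕ) : ℤ) := isPeriodicCfg_flatCfg _
  have hV₀P' : IsPeriodicCfg V₀ ((L : ℤ) * (tower L N 0 : ℕ)) := isPeriodicCfg_flatCfg _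
  -- the smallness radius for the one-step average
  have htls : 0 < twoLevelSmall 4 L := by
    have hL0 : (0 : ℝ) < L := by exact_mod_cast (lt_of_lt_of_le zero_lt_one hL)
    unfold twoLevelSmall; positivity
  set x : ℝ := 1 / twoLevelSmall 4 L with hx
  have hx0 : 0 < x := by rw [hx]; positivity
  have hls : LevelSmall 4 L 0 x := by
    show twoLevelSmall 4 L * x ≤ 1
    rw [hx, mul_one_div_cancel htls.ne']
  have hV₀x : SmallField V₀ x := MinimalActionRate.SmallField.mono (by rw [hV₀def]; exact smallField_flatCfg_zero) hx0.le
  -- the actions at the two levels and the averaging map in the charts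
  set AM : ↥(skewSub 4 n (L * N)) → ℝ := fun s => fineAction (chart (ContinuousLinearMap.id ℝ (Matrix n n ℂ)) (L * N) V₀ (s : TDir 4 n (L * N))) (perWin 4 (L * N)) with hAM
  set AN : ↥(skewSub 4 n N) → ℝ := fun s => fineAction (chart (ContinuousLinearMap.id ℝ (Matrix n n ℂ)) N V₀ (s : TDir 4 n N)) (perWin 4 N) with hAN
  set Θ : ↥(skewSub 4 n (L * N)) → ↥(skewSub 4 n N) := fun s => levelQ L N 0 V₀ (chart (ContinuousLinearMap.id ℝ (Matrix n n ℂ)) (L * N) V₀ (s : TDir 4 n (L * N))) with hΘ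
  have hAMc : ContDiffAt ℝ 2 AM 0 := by
    have h1 : ContDiffAt ℝ 2 (fun Φ : TDir 4 n (L * N) => fineAction (chart (ContinuousLinearMap.id ℝ (Matrix n n ℂ)) (L * N) V₀ Φ) (perWin 4 (L * N))) ((skewSub 4 n (L * N)).subtypeL 0) := by
      rw [map_zero]; exact contDiffAt_fineAction_chart (m := 2) (ContinuousLinearMap.id ℝ (Matrix n n ℂ)) (L * N) V₀ (perWin 4 (L * N)) 0
    exact h1.comp 0 (skewSub 4 n (L * N)).subtypeL.contDiff.contDiffAt
  have hANc : ContDiffAt ℝ 2 AN 0 := by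
    have h1 : ContDiffAt ℝ 2 (fun Φ : TDir 4 n N => fineAction (chart (ContinuousLinearMap.id ℝ (Matrix n n ℂ)) N V₀ Φ) (perWin 4 N)) ((skewSub 4 n N).subtypeL 0) := by
      rw [map_zero]; exact contDiffAt_fineAction_chart (m := 2) (ContinuousLinearMap.id ℝ (Matrix n n ℂ)) N V₀ (perWin 4 N) 0
    exact h1.comp 0 (skewSub 4 n N).subtypeL.contDiff.contDiffAt
  have hAN0 : AN 0 = 0 := by simp only [hAN, Submodule.coe_zero, chart_zero, hV₀def, fineAction_flatCfg]
  have hΘc : ContDiffAt ℝ 2 Θ 0 := by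
    have h1 : ContDiffAt ℝ 2 (fun Φ : TDir 4 n (L * tower L N 0) => levelQ L N 0 V₀ (chart (ContinuousLinearMap.id ℝ (Matrix n n ℂ)) (L * tower L N 0) V₀ Φ))
        ((skewSub 4 n (L * N)).subtypeL 0) := by
      rw [map_zero]; exact contDiffAt_levelQ (d := 4) (m := 2) hL 0 hV₀u hV₀P' hx0.le hls hV₀x
    exact h1.comp 0 (skewSub 4 n (L * N)).subtypeL.contDiff.contDiffAt
  have hΘ0 : Θ 0 = 0 := by simp only [hΘ, Submodule.coe_zero, chart_zero, levelQ_self]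
  -- decoding near `0`: `chart_N 1 (Θ s) = cavg L (chart_{LN} 1 s)`
  have hval0 : Tendsto (fun s : ↥(skewSub 4 n (L * N)) => (s : TDir 4 n (L * N))) (𝓝 0) (𝓝 0) := by
    have h := continuous_subtype_val.tendsto (0 : ↥(skewSub 4 n (L * N))); rwa [Submodule.coe_zero] at h
  have hsmall : ∀ᶠ s : ↥(skewSub 4 n (L * N)) in 𝓝 0, SmallField (chart (ContinuousLinearMap.id ℝ (Matrix n n ℂ)) (L * N) V₀ (s : TDir 4 n (L * N))) x :=
    hval0.eventually (eventually_smallField_chart (ContinuousLinearMap.id ℝ (Matrix n n ℂ)) (L * N) hV₀PM hx0 (by rw [hV₀def]; exact smallField_flatCfg_zero))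
  have hnear : ∀ᶠ s : ↥(skewSub 4 n (L * N)) in 𝓝 0, ∀ (r : Fin 4 → Fin N) (κ' : Fin 4),
      ‖(((V₀ (boxVec N r) κ')⁻¹ : (Matrix n n ℂ)ˣ) : Matrix n n ℂ)
        * (cavgIter L 1 (chart (ContinuousLinearMap.id ℝ (Matrix n n ℂ)) (L * N) V₀ (s : TDir 4 n (L * N))) (boxVec N r) κ' : Matrix n n ℂ) - 1‖ ≤ 1 / 4 := by
    have hev : ∀ᶠ η : TDir 4 n (L * N) in 𝓝 0, ∀ (r : Fin 4 → Fin N) (κ' : Fin 4),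
        ‖(((V₀ (boxVec N r) κ')⁻¹ : (Matrix n n ℂ)ˣ) : Matrix n n ℂ)
          * (cavgIter L 1 (chart (ContinuousLinearMap.id ℝ (Matrix n n ℂ)) (L * N) V₀ η) (boxVec N r) κ' : Matrix n n ℂ) - 1‖ ≤ 1 / 4 := by
      refine Filter.eventually_all.mpr fun r => Filter.eventually_all.mpr fun κ' => ?_
      have hc0 := continuousAt_cavgIter_chart (d := 4) (n := n) hL N 0 (ContinuousLinearMap.id ℝ (Matrix n n ℂ)) hV₀u hV₀P' hx0.le hls hV₀x (boxVec N r) κ'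
      have hcn : ContinuousAt (fun η : TDir 4 n (L * N) => ‖(((V₀ (boxVec N r) κ')⁻¹ : (Matrix n n ℂ)ˣ) : Matrix n n ℂ)
          * ((cavgIter L 1 (chart (ContinuousLinearMap.id ℝ (Matrix n n ℂ)) (L * N) V₀ η) (boxVec N r) κ' : (Matrix n n ℂ)ˣ) : Matrix n n ℂ) - 1‖) 0 :=
        ((continuousAt_const.mul hc0).sub continuousAt_const).norm
      have h0 : ‖(((V₀ (boxVec N r) κ')⁻¹ : (Matrix n n ℂ)ˣ) : Matrix n n ℂ)
          * ((cavgIter L 1 (chart (ContinuousLinearMap.id ℝ (Matrix n n ℂ)) (L * N) V₀ 0) (boxVec N r) κ' : (Matrix n n ℂ)ˣ) : Matrix n n ℂ) - 1‖ < 1 / 4 := by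
        have e : cavgIter L 1 (chart (ContinuousLinearMap.id ℝ (Matrix n n ℂ)) (L * N) V₀ 0) = V₀ := by
          rw [chart_zero]; show cavg L V₀ = V₀; rw [cavg_eq_rescale_bavg, hV₀def, rescale_bavg_flatCfg]
        rw [e, Units.inv_mul, sub_self, norm_zero]; norm_num
      exact (hcn.eventually (gt_mem_nhds h0)).mono fun η hη => hη.le
    exact hval0.eventually hev
  have hdecode : ∀ᶠ s : ↥(skewSub 4 n (L * N)) in 𝓝 0,
      chart (ContinuousLinearMap.id ℝ (Matrix n n ℂ)) N V₀ ((Θ s : ↥(skewSub 4 n N)) : TDir 4 n N)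
        = cavg L (chart (ContinuousLinearMap.id ℝ (Matrix n n ℂ)) (L * N) V₀ (s : TDir 4 n (L * N))) := by
    filter_upwards [hsmall, hnear] with s hs hn
    set U : Site 4 → Fin 4 → (Matrix n n ℂ)ˣ := chart (ContinuousLinearMap.id ℝ (Matrix n n ℂ)) (L * N) V₀ (s : TDir 4 n (L * N)) with hU
    have hUu : IsUnitaryCfg U := by rw [hU, chart_id_eq_chart_skewP V₀ s.2]; exact isUnitaryCfg_chart (L * N) hV₀u _
    have hUP : IsPeriodicCfg U ((L * N : ℕ) : ℤ) := isPeriodicCfg_chart _ (L * N) hV₀PM _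
    obtain ⟨hcu, -, -⟩ := cavgIter_unitary_small (d := 4) hL 0 hUu hx0.le hls hs
    have hcP : IsPeriodicCfg (cavgIter L 1 U) (N : ℤ) := isPeriodicCfg_cavgIter L N 1 (by simpa [tower] using hUP)
    have hΘs : ((Θ s : ↥(skewSub 4 n N)) : TDir 4 n N) = ((skewPR N (relLog N V₀ (cavgIter L 1 U)) : ↥(skewSub 4 n N)) : TDir 4 n N) := by
      have e1 : cavgIter L 1 V₀ = V₀ := by show cavg L V₀ = V₀; rw [cavg_eq_rescale_bavg, hV₀def, rescale_bavg_flatCfg]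
      show ((skewPR N (relLog N (cavgIter L 1 V₀) (cavgIter L 1 U)) : ↥(skewSub 4 n N)) : TDir 4 n N) = _
      rw [e1]
    rw [hΘs, chart_skewPR_relLog_eq hV₀u hcu hV₀PN hcP hn]
    rfl
  -- the deficit near `0` as the difference of the two chart actions
  have hEq : (fun s : ↥(skewSub 4 n (L * N)) => deficit L (chart (ContinuousLinearMap.id ℝ (Matrix n n ℂ)) (L * N) V₀ (s : TDir 4 n (L * N)))
        (blockWindow L (periodBox (d := 4) N))) =ᶠ[𝓝 0] fun s : ↥(skewSub 4 n (L * N)) => 1 * AN (Θ s) - AM s := by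
    filter_upwards [hdecode] with s hs
    have hw2 : (blockWindow L (periodBox (d := 4) N)).2 = perWin 4 (L * N) := blockWindow_periodBox_snd L N hL
    have hw1 : (blockWindow L (periodBox (d := 4) N)).1 = perWin 4 N := rfl
    show (L : ℝ) ^ (((4 : ℕ) : ℤ) - 4) * coarseAction L _ (blockWindow L (periodBox (d := 4) N)).1 - fineAction _ (blockWindow L (periodBox (d := 4) N)).2 = 1 * AN (Θ s) - AM s
    rw [hw1, hw2, show (((4 : ℕ) : ℤ) - 4) = 0 by norm_num, zpow_zero, ← fineAction_rescale_bavg, ← cavg_eq_rescale_bavg, ← hs]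
  -- `C²`
  have hANΘc : ContDiffAt ℝ 2 (fun s : ↥(skewSub 4 n (L * N)) => AN (Θ s)) 0 := by
    have h1 : ContDiffAt ℝ 2 AN (Θ 0) := by rw [hΘ0]; exact hANc
    exact ContDiffAt.comp (g := AN) (f := Θ) 0 h1 hΘc
  exact ((contDiffAt_const.mul hANΘc).sub hAMc).congr_of_eventuallyEq hEq

end

end Summit.QuantumFields.BalabanUV.T4Continuum.NE7DeficitChartSmoothFlat
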